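/-
Copyright: statement-level skeleton of a published paper (lit-balaban cell, Phase-2 proof seat p39 gen 16). No proof claims
beyond what the kernel checks below.
-/
import Literature.MathematicalPhysics.QuantumFieldTheory.Balaban1983to89.B3BilinearWick

/-!
# B3 — T. Bałaban, *(Higgs)₂,₃ quantum fields in a finite volume. III. Renormalization*, CMP **88** (1983) 411–445
[Balaban1983Higgs3], p. 431 L20 *"differentiating (2.24) to higher order in A"* and p. 434 *"tr q^{2n+1} = 0"*: **the
parity of the Ward–Takahashi identities of all orders** — the integrand of order `n` is homogeneous of degree `n + 1` in the
charge matrix `q`, so at `F = 1`, `A = 0` every EVEN-order identity holds by the antisymmetry of `q` alone (Furry), on the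
concrete lattice model

statement-level skeleton of published theorems with citation tags; proofs where landed; nothing here is a claim about
the Yang–Mills mass gap

PDF held: `paper:balaban1983-higgs-2-3-quantum-fields-finite-volume` (journal page = PDF page + 410); pp. 430–431 [PDF 20–21],
p. 434 [PDF 24] read (`lit read`).

CITATION HEADER (lean-in-tree rule).  Part of the lit-balaban TYPED SKELETON (HOME `run/shared/lean/pub/lit-balaban/`), PHASE 2,
proof seat p39 (generation 16).  Rows **B3.Eq2.26-2.28** (p. 431; owner r15; member `B3WT224HigherOrder` = (2.24) to all orders
in `A`) and **B3.Txt@434** (p. 434: graphs with an odd number of external vector legs vanish since *"every graph of this type has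
at least one loop of scalar field lines with an odd number of vector field legs, thus with an odd power of q, and we have
tr q^{2n+1} = 0"*).  Sequel of this seat's `B3WT224HigherOrder` (the integrands `Pseq λ [Bₙ,…,B₁]` of the `A`-derivatives of
(2.24) in the polynomial ring `WTPoly = MvPolynomial (PBond × ℕ) ℝ` of the bond atoms `X_{b,m} = ⟪φ(b₋),q^mU(A_b)φ(b₊)⟫`, the
derivation `DB`, `step`, `ev`) and `B3BilinearWick` (Furry's theorem for the lattice model, `integral_prod_qleg_eq_zero_of_odd'`),
BY NAME; Mathlib's weighted-homogeneous polynomials (`MvPolynomial.IsWeightedHomogeneous`, weight `Prod.snd : (b,m) ↦ m`).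

WHAT THIS FILE PROVES (theorems only; no definition, no named fact, no `sorry`).
* §1 **the `q`-degree**: with the weight `(b,m) ↦ m` (`Prod.snd`; the power of `q` in the atom `X_{b,m}`), the currents `cur m a` are
  homogeneous of degree `m` (`isWeightedHomogeneous_cur`), the derivation `DB B` RAISES the degree by one
  (`isWeightedHomogeneous_DB`: `X_{b,m} ↦ ηeB_bX_{b,m+1}`, via `MvPolynomial.mkDerivation_monomial` and
  `Finsupp.weight_sub_single_add`), hence so does `step B` (`isWeightedHomogeneous_step`), and **the order-`n` integrand
  `Pseq λ [Bₙ,…,B₁]` is homogeneous of `q`-degree `n + 1`** (`isWeightedHomogeneous_Pseq`).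
* §2 **odd `q`-degree integrates to zero at `A = 0`** (`integral_ev_zero_eq_zero_of_odd`): for every `p` homogeneous of odd
  `q`-degree, `∫dφ e^{−½⟨φ,(−Δ^η+M²)φ⟩} ev_0(p)(φ) = 0` — each monomial is a product of `q`-currents `⟪φ(b₋),q^mφ(b₊)⟫` with odd
  total power (`ev_zero_monomial_eq`), killed by Furry's theorem `B3BilinearWick.integral_prod_qleg_eq_zero_of_odd'`; growth
  bookkeeping `expGrowth_ev`.
* §3 **THE PARITY THEOREM** (`integral_ev_Pseq_eq_zero_of_even`, `integral_iteratedDeriv_eq_zero_of_even`): for EVEN `n`,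
  `∫dφ e^{−½⟨φ,(−Δ^η+M²)φ⟩} ev_0(Pseq λ [Bₙ,…,B₁])(φ) = 0` and
  `∫dφ dⁿ/dsⁿ|_{s=0}[e^{−½⟨φ,(−Δ^η_{sB}+M²)φ⟩}⟨D^η_{sB}φ,∂^ηλqU(sB)φ⟩] = 0`
  WITHOUT gauge invariance, WITHOUT `cηe ≠ 0` — by the antisymmetry of `q` alone: the even-order Ward–Takahashi identities of
  `B3WT224HigherOrder.eq224_iteratedDeriv_zero` at `F = 1` carry no information beyond `tr q^{2n+1} = 0` (p. 434); the odd orders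
  (`n = 1`: (2.26)–(2.28); `n = 3`: four vector legs, the first higher identity with content) are the genuine ones.
HONEST SCOPE: `F = 1`, `A = 0`, the model torus; a statement about the LEFT members (Gaussian integrals), no pictures drawn.
Mathlib + the cited tree files only; standard axioms.  Unit `lit-balaban-p39-g16` (Phase-2 proof seat p39, gen 16), HOME
`run/shared/lean/pub/lit-balaban/`, 2026-08-22.

References: [Balaban1983Higgs3] T. Bałaban, CMP 88 (1983) 411–445, (2.24)–(2.28) pp. 430–431, p. 434; [Balaban1982Higgs1]
T. Bałaban, CMP 85 (1982) 603–636, (1.7) p. 605 (`q* = −q`).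
-/

noncomputable section

open scoped BigOperators InnerProductSpace

namespace Literature.MathematicalPhysics.QuantumFieldTheory.Balaban1983to89.B3WTOrderParity

open _root_.MeasureTheory MvPolynomial
open LatticeFieldCalculus B3WT223Instance B3WT224Instance B3WTPropagator B3WTCovariance B3WickVertexCalculus
  B3WT228Graphs B3WT226Pairings B3WT224HigherOrder B3BilinearWick

variable {P : Params} {j N : ℕ} (C : HiggsLattice.ChargeData N) (η w c M2 : ℝ)

/-! ## §1 The `q`-degree of the integrands -/

omit C η in
/-- the currents `cur m a = −Σ_b η^dca_bX_{b,m}` are homogeneous of `q`-degree `m`. [cite: Balaban1983Higgs3, p.434] -/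
theorem isWeightedHomogeneous_cur (m : ℕ) (a : PBond P j → ℝ) :
    IsWeightedHomogeneous (Prod.snd : PBond P j × ℕ → ℕ) (cur w c m a) m := by
  unfold cur
  exact IsWeightedHomogeneous.sum _ _ _ fun b _ => (isWeightedHomogeneous_X ℝ (Prod.snd : PBond P j × ℕ → ℕ) (b, m)).C_mul _

omit C η in
/-- `J_B = cur 1 B` has `q`-degree `1`. [cite: Balaban1983Higgs3, (2.26) p.431] -/
theorem isWeightedHomogeneous_pJ (B : VecField P j ℝ) : IsWeightedHomogeneous (Prod.snd : PBond P j × ℕ → ℕ) (pJ w c B) 1 :=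
  isWeightedHomogeneous_cur w c 1 B

omit C η in
/-- `P_λ` has `q`-degree `1`. [cite: Balaban1983Higgs3, (2.24) p.430] -/
theorem isWeightedHomogeneous_pDA (lam : Site P j → ℝ) : IsWeightedHomogeneous (Prod.snd : PBond P j × ℕ → ℕ) (pDA w c lam) 1 :=
  isWeightedHomogeneous_cur w c 1 (grad c lam)

/-- **the derivation `DB B` raises the `q`-degree by one** (`X_{b,m} ↦ ηeB_bX_{b,m+1}` on monomials, Leibniz).
[cite: Balaban1983Higgs3, p.431 L20; p.434] -/
theorem isWeightedHomogeneous_DB (B : VecField P j ℝ) {p : WTPoly P j} {n : ℕ}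
    (hp : IsWeightedHomogeneous (Prod.snd : PBond P j × ℕ → ℕ) p n) :
    IsWeightedHomogeneous (Prod.snd : PBond P j × ℕ → ℕ) (DB C η B p) (n + 1) := by
  induction hp using IsWeightedHomogeneous.induction_on with
  | zero => simpa only [map_zero] using isWeightedHomogeneous_zero ℝ (Prod.snd : PBond P j × ℕ → ℕ) (n + 1)
  | add p q hp hq ihp ihq => simpa only [map_add] using ihp.add ihq
  | monomial d r hr =>
    rw [DB, MvPolynomial.mkDerivation_monomial, MvPolynomial.smul_eq_C_mul]
    refine IsWeightedHomogeneous.C_mul ?_ r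
    refine IsWeightedHomogeneous.sum _ _ _ fun i hi => ?_
    have hi' : d i ≠ 0 := Finsupp.mem_support_iff.mp hi
    have hw := Finsupp.weight_sub_single_add (w := (Prod.snd : PBond P j × ℕ → ℕ)) hi'
    have h1 : IsWeightedHomogeneous (Prod.snd : PBond P j × ℕ → ℕ) (monomial (d - Finsupp.single i 1) ((d i : ℕ) : ℝ))
        (Finsupp.weight (Prod.snd : PBond P j × ℕ → ℕ) (d - Finsupp.single i 1)) := isWeightedHomogeneous_monomial _ _ _ rfl
    have h2 : IsWeightedHomogeneous (Prod.snd : PBond P j × ℕ → ℕ)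
        (MvPolynomial.C (η * C.e * B i.1) * X (i.1, i.2 + 1) : WTPoly P j) (i.2 + 1) :=
      (isWeightedHomogeneous_X ℝ (Prod.snd : PBond P j × ℕ → ℕ) (i.1, i.2 + 1)).C_mul _
    have h3 := h1.mul h2
    dsimp only
    rw [smul_eq_mul]
    convert h3 using 1
    have hq : Prod.snd i = i.2 := rfl
    omega

/-- **`step B` raises the `q`-degree by one**: `step B p = −cηe·J_B·p + DB B p` with `J_B` of degree `1`.
[cite: Balaban1983Higgs3, p.431 L20; p.434] -/
theorem isWeightedHomogeneous_step (B : VecField P j ℝ) {p : WTPoly P j} {n : ℕ}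
    (hp : IsWeightedHomogeneous (Prod.snd : PBond P j × ℕ → ℕ) p n) :
    IsWeightedHomogeneous (Prod.snd : PBond P j × ℕ → ℕ) (step C η w c B p) (n + 1) := by
  unfold step
  have h1 : IsWeightedHomogeneous (Prod.snd : PBond P j × ℕ → ℕ) (MvPolynomial.C (-(c * η * C.e)) * pJ w c B * p) (1 + n) :=
    ((isWeightedHomogeneous_pJ w c B).C_mul _).mul hp
  rw [add_comm] at h1
  exact h1.add (isWeightedHomogeneous_DB C η B hp)

/-- **the order-`n` integrand `Pseq λ [Bₙ,…,B₁]` is homogeneous of `q`-degree `n + 1`** (one `q` from the (2.24)-pairing, one more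
per differentiation in `A`). [cite: Balaban1983Higgs3, p.431 L20; p.434] -/
theorem isWeightedHomogeneous_Pseq (lam : Site P j → ℝ) (Bs : List (VecField P j ℝ)) :
    IsWeightedHomogeneous (Prod.snd : PBond P j × ℕ → ℕ) (Pseq C η w c lam Bs) (Bs.length + 1) := by
  induction Bs with
  | nil => simpa using isWeightedHomogeneous_pDA w c lam
  | cons B Bs ih =>
    rw [Pseq_cons, List.length_cons]
    exact isWeightedHomogeneous_step C η w c B ih

/-! ## §2 Odd `q`-degree integrates to zero at `A = 0` -/

omit w c M2 in
/-- the evaluated integrands have exponential-linear growth (`B3WT224HigherOrder.exists_bound_ev`, `continuous_ev`;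
`(1 + sup|φ|)^d ≤ e^{d·sup|φ|}`). [cite: Balaban1983Higgs3, (2.24) p.430 (the admissible F)] -/
theorem expGrowth_ev (A : VecField P j ℝ) (p : WTPoly P j) : ExpGrowth (fun φ : Cfg P j N => ev C η A φ p) := by
  obtain ⟨K, d, hK, hb⟩ := exists_bound_ev C η (P := P) (j := j) p
  refine ⟨continuous_ev C η A p, K, d, hK, Nat.cast_nonneg d, fun φ => (hb A φ).trans ?_⟩
  have h1 : 1 + ‖φ‖ ≤ Real.exp ‖φ‖ := by linarith [Real.add_one_le_exp ‖φ‖]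
  have h2 : (1 + ‖φ‖) ^ d ≤ Real.exp (d * ‖φ‖) :=
    calc (1 + ‖φ‖) ^ d ≤ (Real.exp ‖φ‖) ^ d := pow_le_pow_left₀ (by positivity) h1 d
      _ = Real.exp (d * ‖φ‖) := by rw [← Real.exp_nat_mul]
  exact mul_le_mul_of_nonneg_left h2 hK

/-- an atom at `A = 0` is the `q`-current `⟪φ(b₋), 1·q^mφ(b₊)⟫` of `B3BilinearWick`. [cite: Balaban1983Higgs3, (2.26) p.431; p.434] -/
theorem atomX_zero_eq_qleg (φ : Cfg P j N) (i : PBond P j × ℕ) :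
    atomX C η (0 : VecField P j ℝ) φ i = qleg C ⟨i.1.src, i.1.tgt, 1, i.2⟩ φ := by
  obtain ⟨b, m⟩ := i
  rw [atomX_zero, qleg_apply, one_smul]

/-- **a monomial in the atoms, at `A = 0`, is a product of `q`-currents with total power = its `q`-weight**:
`ev_0(X^d)(φ) = ∏_{(i,k) : i ∈ supp d, k < d i} qleg⟨i⟩(φ)` (each atom repeated `d i` times).
[cite: Balaban1983Higgs3, p.434 ("an odd power of q")] -/
theorem ev_zero_monomial_eq (φ : Cfg P j N) (d : PBond P j × ℕ →₀ ℕ) (r : ℝ) :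
    ev C η (0 : VecField P j ℝ) φ (monomial d r) =
      r * ∏ ik ∈ d.support.sigma (fun i => (Finset.univ : Finset (Fin (d i)))),
        qleg C (⟨ik.1.1.src, ik.1.1.tgt, 1, ik.1.2⟩ : QLeg P j) φ := by
  rw [ev, MvPolynomial.eval_monomial, Finsupp.prod, Finset.prod_sigma]
  congr 1
  refine Finset.prod_congr rfl fun i _ => ?_
  dsimp only
  rw [Finset.prod_const, Finset.card_univ, Fintype.card_fin, ← atomX_zero_eq_qleg]

omit C w c M2 in
/-- the total power of such a product is the `q`-weight of the monomial. [cite: Balaban1983Higgs3, p.434] -/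
theorem sum_pw_sigma_eq_weight (d : PBond P j × ℕ →₀ ℕ) :
    ∑ ik ∈ d.support.sigma (fun i => (Finset.univ : Finset (Fin (d i)))),
        (⟨ik.1.1.src, ik.1.1.tgt, (1 : ℝ), ik.1.2⟩ : QLeg P j).pw = Finsupp.weight (Prod.snd : PBond P j × ℕ → ℕ) d := by
  rw [Finset.sum_sigma, Finsupp.weight_apply, Finsupp.sum]
  refine Finset.sum_congr rfl fun i _ => ?_
  simp only [Finset.sum_const, Finset.card_univ, Fintype.card_fin, smul_eq_mul]

/-- **a monomial of odd `q`-weight integrates to zero at `A = 0`** (Furry, `B3BilinearWick.integral_prod_qleg_eq_zero_of_odd'`).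
[cite: Balaban1983Higgs3, p.434] -/
theorem integral_ev_monomial_eq_zero_of_odd (hw : 0 < w) (hM : 0 < M2) (d : PBond P j × ℕ →₀ ℕ) (r : ℝ)
    (hodd : Odd (Finsupp.weight (Prod.snd : PBond P j × ℕ → ℕ) d)) :
    ∫ φ, weight C η w c M2 (0 : VecField P j ℝ) φ * ev C η (0 : VecField P j ℝ) φ (monomial d r) = 0 := by
  classical
  simp_rw [ev_zero_monomial_eq]
  have hF := integral_prod_qleg_eq_zero_of_odd' C η w c M2 hw hM
    (d.support.sigma (fun i => (Finset.univ : Finset (Fin (d i)))))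
    (fun ik => (⟨ik.1.1.src, ik.1.1.tgt, 1, ik.1.2⟩ : QLeg P j)) (by rw [sum_pw_sigma_eq_weight]; exact hodd)
  calc ∫ φ, weight C η w c M2 (0 : VecField P j ℝ) φ * (r * ∏ ik ∈ d.support.sigma (fun i => (Finset.univ : Finset (Fin (d i)))),
          qleg C (⟨ik.1.1.src, ik.1.1.tgt, 1, ik.1.2⟩ : QLeg P j) φ)
      = r * ∫ φ, weight C η w c M2 (0 : VecField P j ℝ) φ * ∏ ik ∈ d.support.sigma (fun i => (Finset.univ : Finset (Fin (d i)))),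
          qleg C (⟨ik.1.1.src, ik.1.1.tgt, 1, ik.1.2⟩ : QLeg P j) φ := by
        rw [← integral_const_mul]
        exact integral_congr_ae (Filter.Eventually.of_forall fun φ => by ring)
    _ = 0 := by rw [hF, mul_zero]

/-- **every integrand of odd `q`-degree integrates to zero at `A = 0`**: `∫dφ e^{−½⟨φ,(−Δ^η+M²)φ⟩}ev_0(p)(φ) = 0` for `p`
homogeneous of odd `q`-degree (by monomials: `IsWeightedHomogeneous.induction_on`). [cite: Balaban1983Higgs3, p.434] -/
theorem integral_ev_zero_eq_zero_of_odd (hw : 0 < w) (hM : 0 < M2) {p : WTPoly P j} {m : ℕ}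
    (hp : IsWeightedHomogeneous (Prod.snd : PBond P j × ℕ → ℕ) p m) (hm : Odd m) :
    ∫ φ, weight C η w c M2 (0 : VecField P j ℝ) φ * ev C η (0 : VecField P j ℝ) φ p = 0 := by
  induction hp using IsWeightedHomogeneous.induction_on with
  | zero => simp
  | add p q hp hq ihp ihq =>
    simp_rw [ev_add, mul_add]
    rw [integral_add (ExpGrowth.integrable C η w c M2 hw hM (expGrowth_ev C η 0 p))
      (ExpGrowth.integrable C η w c M2 hw hM (expGrowth_ev C η 0 q)), ihp, ihq, add_zero]
  | monomial d r hr => exact integral_ev_monomial_eq_zero_of_odd C η w c M2 hw hM d r (hr ▸ hm)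

/-! ## §3 The parity theorem: even orders vanish by the antisymmetry of `q` alone -/

/-- **THE PARITY THEOREM** (p. 434 mechanism for the all-orders Ward–Takahashi integrands of p. 431): for an EVEN number of
differentiations `[Bₙ,…,B₁]`, `∫dφ e^{−½⟨φ,(−Δ^η+M²)φ⟩} ev_0(Pseq λ [Bₙ,…,B₁])(φ) = 0` — with NO gauge-invariance input and no
condition on the charge `cηe`: the integrand has odd `q`-degree `n + 1`, so every Wick term carries a loop with an odd power of `q`
(`tr q^{2n+1} = 0`).  Compare `B3WT224HigherOrder.eq224_allOrders_zero` (all `n`, every `F`, from gauge invariance).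
[cite: Balaban1983Higgs3, p.431 L20; p.434] -/
theorem integral_ev_Pseq_eq_zero_of_even (hw : 0 < w) (hM : 0 < M2) (lam : Site P j → ℝ) (Bs : List (VecField P j ℝ))
    (hBs : Even Bs.length) : ∫ φ, weight C η w c M2 (0 : VecField P j ℝ) φ * ev C η (0 : VecField P j ℝ) φ (Pseq C η w c lam Bs) = 0 :=
  integral_ev_zero_eq_zero_of_odd C η w c M2 hw hM (isWeightedHomogeneous_Pseq C η w c lam Bs) hBs.add_one

/-- **the even `A`-derivatives of the (2.24) integrand integrate to zero by parity**: for even `n` and every direction `B`,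
`∫dφ dⁿ/dsⁿ|_{s=0}[e^{−½⟨φ,(−Δ^η_{sB}+M²)φ⟩}⟨D^η_{sB}φ, ∂^ηλqU(sB)φ⟩] = 0` (`F = 1`), from `q* = −q` alone — the even-order cases of
`B3WT224HigherOrder.eq224_iteratedDeriv_zero` are automatic; the content of *"higher order in A"* sits in the odd orders.
[cite: Balaban1983Higgs3, p.431 L20; p.434] -/
theorem integral_iteratedDeriv_eq_zero_of_even (hw : 0 < w) (hM : 0 < M2) (B : VecField P j ℝ) (lam : Site P j → ℝ)
    {n : ℕ} (hn : Even n) :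
    ∫ φ, iteratedDeriv n (fun s : ℝ => weight C η w c M2 (s • B) φ * pairDA C η w c (s • B) lam φ) 0 = 0 := by
  have key : ∀ φ : Cfg P j N,
      iteratedDeriv n (fun s : ℝ => weight C η w c M2 (s • B) φ * pairDA C η w c (s • B) lam φ) 0 =
        weight C η w c M2 (0 : VecField P j ℝ) φ * ev C η (0 : VecField P j ℝ) φ (Pseq C η w c lam (List.replicate n B)) :=
        fun φ => by
    have h := iteratedDeriv_weight_mul_ev C η w c M2 (0 : VecField P j ℝ) B φ (pDA w c lam) n
    simp only [ev_pDA, zero_add] at h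
    rw [h, Pseq_replicate]
    simp only [zero_smul]
  simp_rw [key]
  exact integral_ev_Pseq_eq_zero_of_even C η w c M2 hw hM lam (List.replicate n B) (by simpa using hn)

end Literature.MathematicalPhysics.QuantumFieldTheory.Balaban1983to89.B3WTOrderParity

end
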